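import Summits.ResolutionOfSingularities.ResolutionOfSingularities.Theorems.ValuativeLuAlphaPTorsorAPFlagSteps
import HarnessLib

/-!
# The residue step keeps a flag-adapted chart flag-adapted

Crux `Valuative.LuAlphaPTorsor` (stmt-ResolutionOfSingularities-0641), line `pfaff-line-log-final-forms`,
lead seat c4 — F⁷ᵇ of the attack on the rank `≥ 2` Abhyankar core: on a flag-adapted chart
`(R, x, lv)`, if `t ^ p = u ∈ R` with `v(u) = 1` and `v(u - c ^ p) = 1` for all
`c ∈ O ∩ Frac R` (the residue of `u` is not a `p`-th power in the residue field of `Frac R`),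
then `R[t]` with the SAME parameters and levels is flag-adapted (`ap_flag_residueStep`). The
point beyond the rank-one residue step (`stub_residueStep`, worker w-S5): for every level `ℓ`
the residue of `u` is not a `p`-th power for the COARSENING `W_ℓ` either (an elementary value
computation, `ap_flag_notPow_coarsening`), so `residueStep_valuation_coeff_lt_one` applies to
`W_ℓ` and the coefficients of a `W_ℓ`-small `∑ rᵢ tⁱ` are `W_ℓ`-small, i.e. in `(x_{≥ℓ})R`.
Anchor (closed form): `ap_flag_notPow_coarsening`. [folklore]
-/

set_option linter.dupNamespace false

open IsLocalRing

namespace Summit.ResolutionOfSingularities.ResolutionOfSingularities.Theorems.PfaffLine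

open Literature.AlgebraicGeometry.Resolution

/-- **"Not a `p`-th power" passes to coarsenings** (registered anchor): if `v(u) = 1` and
`v(u - c^p) = 1` for all `c ∈ O ∩ M`, then for every overring `W ⊇ O` whose non-units are
`O`-non-units, `w(u - c^p) = 1` for all `c ∈ W ∩ M`. [folklore] -/
theorem ap_flag_notPow_coarsening : ∀ {K : Type} [Field K] (O W : ValuationSubring K), O ≤ W → (∀ z : K, W.valuation z < 1 → O.valuation z < 1) → ∀ (M : Subfield K) (p : ℕ), p ≠ 0 → ∀ (u : K), O.valuation u = 1 → (∀ c : K, c ∈ O → c ∈ M → O.valuation (u - c ^ p) = 1) → ∀ c : K, c ∈ W → c ∈ M → W.valuation (u - c ^ p) = 1 := by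
  intro K _ O W hOW hWO M p hp u hu hc c hcW hcM
  have huW : W.valuation u = 1 := ap_flag_unit_W O W hOW u hu
  by_cases hcs : W.valuation c < 1
  · have hcp : W.valuation (-c ^ p) < W.valuation u := by
      rw [Valuation.map_neg, map_pow, huW]; exact pow_lt_one₀ zero_le hcs hp
    rw [sub_eq_add_neg, Valuation.map_add_eq_of_lt_left _ hcp, huW]
  · have hcu : W.valuation c = 1 := le_antisymm ((W.valuation_le_one_iff c).mpr hcW) (not_lt.mp hcs)
    by_cases hcO : c ∈ O
    · exact ap_flag_unit_W O W hOW _ (hc c hcO hcM)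
    · -- `c ∉ O`: `v(c^p) > 1 = v(u)`, so `v(u - c^p) > 1`, which `W`-smallness would contradict
      have hgt : 1 < O.valuation c := by
        rw [← not_le, O.valuation_le_one_iff]; exact hcO
      have hle : W.valuation (u - c ^ p) ≤ 1 :=
        (W.valuation_le_one_iff _).mpr (W.sub_mem (hOW ((O.valuation_le_one_iff u).mp hu.le)) (W.pow_mem hcW p))
      refine le_antisymm hle (not_lt.mp fun hlt => ?_)
      have h1 := hWO _ hlt
      have hcp : O.valuation u < O.valuation (-c ^ p) := by
        rw [Valuation.map_neg, map_pow, hu]; exact one_lt_pow₀ hgt hp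
      rw [sub_eq_add_neg, Valuation.map_add_eq_of_lt_right _ hcp, Valuation.map_neg, map_pow] at h1
      exact absurd (lt_trans (one_lt_pow₀ hgt hp) h1) (lt_irrefl _)

section Residue

variable {k K : Type} [Field k] [Field K] [Algebra k K]

set_option maxHeartbeats 400000 in
/-- **The residue step keeps a flag-adapted chart flag-adapted** (same parameters, same levels).
[folklore] -/
theorem ap_flag_residueStep {p : ℕ} (hp : p.Prime) (O : ValuationSubring K)
    (hk : ∀ c : k, algebraMap k K c ∈ O) {n : ℕ} (R : Subalgebra k K) (hRO : R.toSubring ≤ O.toSubring)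
    (x : Fin n → K) (hx : ∀ i, x i ∈ R) (lv : Fin n → ℕ) (hflag : FlagAdaptedChart O R hRO x hx lv)
    (t u : K) (huR : u ∈ R) (hu : O.valuation u = 1) (htp : t ^ p = u)
    (hc : ∀ c : K, c ∈ O → c ∈ Subfield.closure (R : Set K) → O.valuation (u - c ^ p) = 1) :
    ∃ (R' : Subalgebra k K) (hR'O : R'.toSubring ≤ O.toSubring) (hx' : ∀ i, x i ∈ R'),
      R' = Algebra.adjoin k (insert t (R : Set K)) ∧ R ≤ R' ∧ t ∈ R' ∧ R'.FG ∧
      ((R' : Set K) ⊆ Subfield.closure ((R : Set K) ∪ {t})) ∧ FlagAdaptedChart O R' hR'O x hx' lv := by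
  classical
  obtain ⟨⟨hFG, hx0, hspan, hind, hAV, hC3⟩, hLA⟩ := id hflag
  have hp0 : p ≠ 0 := hp.ne_zero
  -- `t` is an `O`-unit
  have htv : O.valuation t = 1 := by
    have h1 : O.valuation t ^ p = 1 := by rw [← map_pow, htp, hu]
    rcases lt_trichotomy (O.valuation t) 1 with h | h | h
    · exact absurd h1 (ne_of_lt (pow_lt_one₀ zero_le h hp0))
    · exact h
    · exact absurd h1 (ne_of_gt (one_lt_pow₀ h hp0))
  have htO : t ∈ O := (O.valuation_le_one_iff t).mp htv.le
  have htR : t ^ p ∈ R := by rw [htp]; exact huR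
  set R' : Subalgebra k K := Algebra.adjoin k (insert t (R : Set K)) with hR'
  have hRR' : R ≤ R' := fun z hz => Algebra.subset_adjoin (Set.mem_insert_of_mem _ hz)
  have htR' : t ∈ R' := Algebra.subset_adjoin (Set.mem_insert _ _)
  have hR'O : R'.toSubring ≤ O.toSubring := by
    intro z hz
    refine (Algebra.adjoin_le (S := { O.toSubring with algebraMap_mem' := fun c => hk c }) ?_) hz
    rintro y (rfl | hy)
    · exact htO
    · exact hRO hy
  have hFG' : R'.FG := by
    obtain ⟨s, hs⟩ := hFG
    refine ⟨insert t s, ?_⟩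
    rw [Finset.coe_insert, hR', ← hs, Algebra.adjoin_insert_adjoin]
  have hsub : (R' : Set K) ⊆ Subfield.closure ((R : Set K) ∪ {t}) := by
    intro z hz
    refine (Algebra.adjoin_le (S := { (Subfield.closure ((R : Set K) ∪ {t})).toSubring with
      algebraMap_mem' := fun c => Subfield.subset_closure (Or.inl (R.algebraMap_mem c)) }) ?_) hz
    rintro y (rfl | hy)
    · exact Subfield.subset_closure (Or.inr rfl)
    · exact Subfield.subset_closure (Or.inl hy)
  have hx' : ∀ i, x i ∈ R' := fun i => hRR' (hx i)
  -- elements of `R'` are `∑_{i<p} rᵢ tⁱ`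
  have hrep : ∀ z ∈ R', ∃ r : Fin p → K, (∀ i, r i ∈ R) ∧ z = ∑ i, r i * t ^ (i : ℕ) := fun z hz =>
    residueStep_exists_sum_eq R hp0 htR (by rw [← hR']; exact hz)
  -- pushing a sum with coefficients in an ideal of `R` into the ideal of `R'`
  have hpush : ∀ (q : Fin n → Prop) (r : Fin p → K) (hr : ∀ i, r i ∈ R) (hz : (∑ i, r i * t ^ (i : ℕ)) ∈ R'),
      (∀ i, (⟨r i, hr i⟩ : R.toSubring) ∈
        Ideal.span (Set.range fun i : {i : Fin n // q i} => (⟨x i.1, hx i.1⟩ : R.toSubring))) →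
      (⟨∑ i, r i * t ^ (i : ℕ), hz⟩ : R'.toSubring) ∈
        Ideal.span (Set.range fun i : {i : Fin n // q i} => (⟨x i.1, hx' i.1⟩ : R'.toSubring)) := by
    intro q r hr hz hmem
    have : (⟨∑ i, r i * t ^ (i : ℕ), hz⟩ : R'.toSubring) =
        ∑ i, (⟨r i, hRR' (hr i)⟩ : R'.toSubring) * ⟨t ^ (i : ℕ), pow_mem htR' _⟩ :=
      Subtype.ext (by push_cast; rfl)
    rw [this]
    refine Submodule.sum_mem _ fun i _ => Ideal.mul_mem_right _ _ ?_
    -- map the `R`-combination into `R'`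
    obtain ⟨c, hc⟩ := Ideal.mem_span_range_iff_exists_fun.mp (hmem i)
    have hcK : (∑ j, (c j : K) * x j.1) = r i := by
      have := congrArg (fun t : R.toSubring => (t : K)) hc
      simp only [AddSubmonoidClass.coe_finsetSum, Subring.coe_mul] at this
      exact this
    have : (⟨r i, hRR' (hr i)⟩ : R'.toSubring) =
        ∑ j, (⟨(c j : K), hRR' (c j).2⟩ : R'.toSubring) * ⟨x j.1, hx' j.1⟩ :=
      Subtype.ext (by push_cast; exact hcK.symm)
    rw [this]
    exact Submodule.sum_mem _ fun j _ => Ideal.mul_mem_left _ _ (Ideal.subset_span ⟨j, rfl⟩)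
  -- the `R`-side smallness of parameters
  have hxsmall : ∀ (ℓ : ℕ) (i : Fin n), ℓ ≤ lv i → ∀ m : Fin n → ℤ, (∀ j, ℓ ≤ lv j → m j = 0) →
      O.valuation (x i) < ∏ j, O.valuation (x j) ^ (m j) := fun ℓ i hi m hm =>
    (hC3 ℓ ⟨x i, hx i⟩).mp (Ideal.subset_span ⟨⟨i, hi⟩, rfl⟩) m hm
  -- (C3) for `R'`
  have hC3' : ∀ (ℓ : ℕ) (z : R'.toSubring),
      z ∈ Ideal.span (Set.range fun i : {i : Fin n // ℓ ≤ lv i} => (⟨x i.1, hx' i.1⟩ : R'.toSubring)) ↔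
        ∀ m : Fin n → ℤ, (∀ j, ℓ ≤ lv j → m j = 0) →
          O.valuation (z : K) < ∏ j, O.valuation (x j) ^ (m j) := by
    intro ℓ z
    constructor
    · intro hz m hm
      obtain ⟨c, hc⟩ := Ideal.mem_span_range_iff_exists_fun.mp hz
      have hzK : (z : K) = ∑ i : {i : Fin n // ℓ ≤ lv i}, (c i : K) * x i.1 := by
        have := congrArg (fun t : R'.toSubring => (t : K)) hc
        simp only [AddSubmonoidClass.coe_finsetSum, Subring.coe_mul] at this
        exact this.symm
      rw [hzK]
      have hpos : 0 < ∏ j, O.valuation (x j) ^ (m j) :=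
        Finset.prod_pos fun j _ => zpow_pos ((Valuation.pos_iff _).mpr (hx0 j)) _
      refine Valuation.map_sum_lt _ (ne_of_gt hpos) fun i _ => ?_
      rw [map_mul]
      exact lt_of_le_of_lt (mul_le_of_le_one_left' ((O.valuation_le_one_iff _).mpr (hR'O (c i).2)))
        (hxsmall ℓ i.1 i.2 m hm)
    · intro h
      -- the level-`ℓ` coarsening
      obtain ⟨W, hOW, hsmall, hWO, hWR⟩ := ap_flag_level O R hRO x hx lv hflag ℓ
      have hRW : R.toSubring ≤ W.toSubring := fun y hy => hOW (hRO hy)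
      have hcW := ap_flag_notPow_coarsening O W hOW hWO (Subfield.closure (R : Set K)) p hp0 u hu hc
      obtain ⟨r, hr, hzr⟩ := hrep z z.2
      have hzW : W.valuation (∑ i, r i * t ^ (i : ℕ)) < 1 := by rw [← hzr]; exact (hsmall _).mpr h
      have hcoef := residueStep_valuation_coeff_lt_one W R hRW hp (hOW htO) huR htp hcW r hr hzW
      have hrmem : ∀ i, (⟨r i, hr i⟩ : R.toSubring) ∈
          Ideal.span (Set.range fun i : {i : Fin n // ℓ ≤ lv i} => (⟨x i.1, hx i.1⟩ : R.toSubring)) :=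
        fun i => (hWR ⟨r i, hr i⟩).mp (hcoef i)
      have hz' : (∑ i, r i * t ^ (i : ℕ)) ∈ R' := by rw [← hzr]; exact z.2
      have hzeq : z = ⟨∑ i, r i * t ^ (i : ℕ), hz'⟩ := Subtype.ext hzr
      rw [hzeq]
      exact hpush (fun i => ℓ ≤ lv i) r hr hz' hrmem
  refine ⟨R', hR'O, hx', rfl, hRR', htR', hFG', hsub, ⟨⟨hFG', hx0, ?_, hind, hAV, hC3'⟩, hLA⟩⟩
  -- span = centre, from (C3) at level `0`
  ext z
  rw [Ideal.mem_comap, ValuationSubring.valuation_lt_one_iff]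
  change _ ↔ O.valuation (z : K) < 1
  have hset : Set.range (fun i => (⟨x i, hx' i⟩ : R'.toSubring)) =
      Set.range (fun i : {i : Fin n // 0 ≤ lv i} => (⟨x i.1, hx' i.1⟩ : R'.toSubring)) := by
    ext w; constructor
    · rintro ⟨i, rfl⟩; exact ⟨⟨i, Nat.zero_le _⟩, rfl⟩
    · rintro ⟨i, rfl⟩; exact ⟨i.1, rfl⟩
  rw [hset, hC3' 0 z]
  constructor
  · intro h; simpa using h 0 (fun _ _ => rfl)
  · intro hz m hm
    have hm0 : m = 0 := funext fun j => hm j (Nat.zero_le _)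
    rw [hm0]; simpa using hz

end Residue

end Summit.ResolutionOfSingularities.ResolutionOfSingularities.Theorems.PfaffLine
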